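import Literature.AnabelianGeometry.SemiGraphs.GraphOfAnabelioids
import Literature.AnabelianGeometry.SemiGraphs.SemiGraphCuspOmission
import Literature.AnabelianGeometry.Anabelioids.AutOfEquivalence

/-!
# Omitting cuspidal (open) edges changes neither `B(𝒢)` nor `Π_𝒢` ([SemiAnbd] §1 p. 13, §2 pp. 22–24; [IUTchI] §2 p. 44)

Mochizuki, *Semi-graphs of anabelioids*, Publ. RIMS **42** (2006) 221–322 [cite: MochizukiSemiAnbd2006,
Def. 2.1 pp.22-24]: for a semi-graph of anabelioids `𝒢` the anabelioid `B(𝒢)` consists of systems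
`{S_v, φ_e}` — in the tree's descent-datum form (`GraphOfAnabelioids.lean`, rendering note 2) objects
`S_v ∈ 𝒢_v`, `T_e ∈ 𝒢_e` and gluing isomorphisms `ψ_b : b^* S_v ⥲ T_e` for every branch `b ∈ e`
ABUTTING to a vertex `v`.  An open edge `e` with exactly one abutting branch `b ⊸ v` (a "cuspidal
edge") therefore carries no information: `(T_e, ψ_b)` is determined by `S_v` up to unique isomorphism.
This is the observation behind Mochizuki, *Inter-universal Teichmüller theory I*, §2, author's
manuscript (May 2020) p. 44 [cite: Mochizuki2012, IUTchI §2 p.44]: "the restriction of `ℋ` to the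
maximal subgraph [cf. the discussion at the beginning of [SemiAnbd], §1] … up to the possible omission
of some of the cuspidal edges … since the omission of cuspidal edges clearly does not affect either the
tempered or pro-`Σ̂` fundamental groups …" (the *maximal subgraph* is "the sub-semi-graph of `G`
obtained by omitting all of the open edges", [SemiAnbd] §1 p. 13, `SemiGraph.maximalSubgraph`).

This file (abc-iut cell, layer L3, row W4-30 "cusp-omission merge lemma"; ADDITIVE — no frozen file is
touched; PROOF-ONLY — theorems, the lifting/extension constructions live inside the proofs) proves the
PROFINITE half of that sentence in the tree's `B(𝒢)` presentation of [SemiAnbd] §2: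

* (`SemiGraphCuspOmission.lean`) `SemiGraph.Subgraph.IsCuspOmission H`: the sub-semi-graph `H ⊆ 𝔾`
  keeps every vertex, and every omitted edge has exactly ONE abutting branch (the sharp hypothesis:
  omitting a closed edge loses a gluing constraint, omitting an isolated edge loses a free factor
  `𝒢_e` of `B(𝒢)`); the maximal subgraph of a connected semi-graph with a vertex is such an `H`, and
  is again connected;
* `SemiGraphOfAnabelioids.isEquivalence_restrictFunctor`: for such `H` the restriction functor
  `B(𝒢) ⥤ B(𝒢_H)` (`restrictFunctor`, [SemiAnbd] p. 24) is an equivalence of categories;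
* `piHToPi_bijective`, `exists_continuousMulEquiv_piHToPi`: hence `Π_{𝒢_H} → Π_𝒢` ([SemiAnbd] p. 24)
  is an isomorphism of profinite groups ("`Π̂` unchanged"), compatibly with the vertex groups
  (`range_piVToPi_eq_map`), so that commensurable terminality of `Π_v` may be checked after cusp
  omission (`isCommensurablyTerminal_range_piVToPi_iff`) — the form in which [SemiAnbd] Cor. 2.7 (i)
  (`corollary_2_7_i`, which binds `IsGraphOfAnabelioids`) applies to a semi-graph of anabelioids
  WITH cusps: apply it to `𝒢_H` and transport;
* `isGraphOfAnabelioids_restrict_maximalSubgraph`, `isConnected_restrict_maximalSubgraph`: after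
  omitting all open edges one has a connected GRAPH of anabelioids; `restrict_V` / `restrict_E`: the
  constituent anabelioids are unchanged.

Not here: the tempered half (`B^temp(𝒢)`, `Π^tp_𝒢`), which lives in the separate presentation
`ProfiniteSemiGraph` / `CovObj` of `TemperedCoverings.lean`.
-/

namespace Literature.AnabelianGeometry.SemiGraphs

open CategoryTheory Literature.AnabelianGeometry.Anabelioids
open scoped Pointwise

universe w v₁ u₁ u

/-! ### `B(𝒢) ⥤ B(𝒢_H)` is an equivalence for a cusp omission `H` ([SemiAnbd] §2 pp. 22–24) -/

namespace SemiGraphOfAnabelioids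

variable {𝒢 : SemiGraphOfAnabelioids.{v₁, u₁, u}} {H : 𝒢.graph.Subgraph}

/-- The constituent anabelioid of `𝒢_H` at a vertex is that of `𝒢` ([SemiAnbd] p. 24,
"`(𝒢_ℍ)_c := 𝒢_c`"). [cite: MochizukiSemiAnbd2006, Def. 2.1 p.24] -/
theorem restrict_V (H : 𝒢.graph.Subgraph) (v : H.toSemiGraph.Vertex) :
    (𝒢.restrict H).V v = 𝒢.V v.1 := rfl

/-- The constituent anabelioid of `𝒢_H` at an edge is that of `𝒢` ([SemiAnbd] p. 24).
[cite: MochizukiSemiAnbd2006, Def. 2.1 p.24] -/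
theorem restrict_E (H : 𝒢.graph.Subgraph) (e : H.toSemiGraph.Edge) :
    (𝒢.restrict H).E e = 𝒢.E e.1 := rfl

/-- **Faithfulness** of `B(𝒢) ⥤ B(𝒢_H)` for a cusp omission: a morphism of `B(𝒢)` is determined by
its vertex components (all kept) — over an omitted cusp `b ⊸ v` its edge component is
`ψ_b⁻¹ ∘ b^*(f_v) ∘ ψ_b`. [cite: MochizukiSemiAnbd2006, Def. 2.1 pp.23-24] -/
theorem faithful_restrictFunctor (hH : H.IsCuspOmission) : (𝒢.restrictFunctor H).Faithful where
  map_injective := by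
    intro A B f g hfg
    have hS : ∀ v : 𝒢.graph.Vertex, f.fS v = g.fS v := fun v =>
      congrArg (fun k => BObj.Hom.fS k (hH.vtx v)) hfg
    refine BObj.hom_ext f g (funext hS) (funext fun e => ?_)
    by_cases he : e ∈ H.edges
    · exact congrArg (fun k => BObj.Hom.fT k (⟨e, he⟩ : H.toSemiGraph.Edge)) hfg
    · obtain ⟨p, hpe, hpv⟩ := hH.exists_cusp e he
      subst hpe
      rw [← cancel_epi (A.ψ p.1 p.2 hpv).hom, ← f.comm p.1 p.2 hpv, ← g.comm p.1 p.2 hpv, hS p.2]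

/-- The gluing along the (unique) abutting branch of a cusp `b₀ ⊸ v₀` is compatible with the edge
component `ψ_{b₀} ∘ b₀^*(g_{v₀}) ∘ ψ_{b₀}⁻¹` forced by a vertex component (transported along
`edgeOf b₀ = edgeOf b`). [cite: MochizukiSemiAnbd2006, Def. 2.1 pp.23-24] -/
theorem comm_cuspFill (hH : H.IsCuspOmission) {A B : 𝒢.BObj}
    (g : (𝒢.restrictFunctor H).obj A ⟶ (𝒢.restrictFunctor H).obj B)
    (b : 𝒢.graph.Branch) (v : 𝒢.graph.Vertex) (h : 𝒢.graph.abuts b = some v)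
    (b₀ : 𝒢.graph.Branch) (v₀ : 𝒢.graph.Vertex) (he₀ : 𝒢.graph.edgeOf b₀ = 𝒢.graph.edgeOf b)
    (h₀ : 𝒢.graph.abuts b₀ = some v₀) (hb : b = b₀) :
    (𝒢.pull b v h).pullback.map (g.fS (hH.vtx v)) ≫ (B.ψ b v h).hom =
      (A.ψ b v h).hom ≫ (he₀ ▸ ((A.ψ b₀ v₀ h₀).inv ≫
        (𝒢.pull b₀ v₀ h₀).pullback.map (g.fS (hH.vtx v₀)) ≫ (B.ψ b₀ v₀ h₀).hom) :
          A.T (𝒢.graph.edgeOf b) ⟶ B.T (𝒢.graph.edgeOf b)) := by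
  subst hb
  have hv : v = v₀ := Option.some_injective _ (h.symm.trans h₀)
  subst hv
  change _ = (A.ψ _ _ h).hom ≫ ((A.ψ _ _ h).inv ≫
    ((𝒢.pull _ _ h).pullback.map (g.fS (hH.vtx _)) ≫ (B.ψ _ _ h).hom))
  exact (Iso.hom_inv_id_assoc (A.ψ _ _ h) _).symm

open Classical in
/-- **Fullness** of `B(𝒢) ⥤ B(𝒢_H)` for a cusp omission: a morphism of `B(𝒢_H)` lifts — vertex
components and kept-edge components as given, cusp-edge components forced.
[cite: MochizukiSemiAnbd2006, Def. 2.1 pp.23-24] -/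
theorem full_restrictFunctor (hH : H.IsCuspOmission) : (𝒢.restrictFunctor H).Full where
  map_surjective {A B} g := by
    refine ⟨{ fS := fun v => g.fS (hH.vtx v)
              fT := fun e => if he : e ∈ H.edges then g.fT ⟨e, he⟩ else
                hH.edgeOf_cusp e he ▸ ((A.ψ _ _ (hH.abuts_cusp e he)).inv ≫
                  (𝒢.pull _ _ (hH.abuts_cusp e he)).pullback.map (g.fS (hH.vtx _)) ≫
                    (B.ψ _ _ (hH.abuts_cusp e he)).hom)
              comm := fun b v h => ?_ }, ?_⟩
    · by_cases he : 𝒢.graph.edgeOf b ∈ H.edges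
      · rw [dif_pos he]
        exact g.comm ⟨b, he⟩ (hH.vtx v) ((H.abuts_mk_eq_some_iff he _).mpr h)
      · rw [dif_neg he]
        exact comm_cuspFill hH g b v h (hH.cusp _ he).1 (hH.cusp _ he).2 (hH.edgeOf_cusp _ he)
          (hH.abuts_cusp _ he) (hH.eq_cusp (he := he) rfl h).1
    · refine BObj.hom_ext _ _ (funext fun v => rfl) (funext fun e => ?_)
      change (if he : e.1 ∈ H.edges then g.fT ⟨e.1, he⟩ else _) = g.fT e
      rw [dif_pos e.2]
      rfl

/-- Over a cusp `b₀ ⊸ v₀`, the pull-back of the vertex object along the (unique) abutting branch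
IS `b₀^* S_{v₀}` (transported along `edgeOf b₀ = edgeOf b`).
[cite: MochizukiSemiAnbd2006, Def. 2.1 pp.23-24] -/
theorem pull_obj_eq_transport (S : ∀ v : 𝒢.graph.Vertex, 𝒢.V v)
    (b : 𝒢.graph.Branch) (v : 𝒢.graph.Vertex) (h : 𝒢.graph.abuts b = some v)
    (b₀ : 𝒢.graph.Branch) (v₀ : 𝒢.graph.Vertex) (he₀ : 𝒢.graph.edgeOf b₀ = 𝒢.graph.edgeOf b)
    (h₀ : 𝒢.graph.abuts b₀ = some v₀) (hb : b = b₀) :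
    (𝒢.pull b v h).pullback.obj (S v) =
      (he₀ ▸ (𝒢.pull b₀ v₀ h₀).pullback.obj (S v₀) : 𝒢.E (𝒢.graph.edgeOf b)) := by
  subst hb
  have hv : v = v₀ := Option.some_injective _ (h.symm.trans h₀)
  subst hv
  rfl

open Classical in
/-- **Essential surjectivity** of `B(𝒢) ⥤ B(𝒢_H)` for a cusp omission: every object of `B(𝒢_H)`
extends to `B(𝒢)` (by `T_e := b^* S_v` over each cusp `b ⊸ v`), and restricts back to itself.
[cite: MochizukiSemiAnbd2006, Def. 2.1 pp.23-24] -/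
theorem essSurj_restrictFunctor (hH : H.IsCuspOmission) : (𝒢.restrictFunctor H).EssSurj where
  mem_essImage A' := by
    -- the extension: vertex objects (all kept), edge objects (given / forced), gluings
    let S : ∀ v : 𝒢.graph.Vertex, 𝒢.V v := fun v => A'.S (hH.vtx v)
    let T : ∀ e : 𝒢.graph.Edge, 𝒢.E e := fun e =>
      if he : e ∈ H.edges then A'.T ⟨e, he⟩ else
        hH.edgeOf_cusp e he ▸ (𝒢.pull _ _ (hH.abuts_cusp e he)).pullback.obj (S (hH.cusp e he).2)
    have hT : ∀ {e : 𝒢.graph.Edge} (he : e ∈ H.edges), T e = A'.T ⟨e, he⟩ := fun he => dif_pos he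
    have hT' : ∀ {e : 𝒢.graph.Edge} (he : e ∉ H.edges), T e = hH.edgeOf_cusp e he ▸
        (𝒢.pull _ _ (hH.abuts_cusp e he)).pullback.obj (S (hH.cusp e he).2) := fun he => dif_neg he
    let ψ : ∀ (b : 𝒢.graph.Branch) (v : 𝒢.graph.Vertex) (h : 𝒢.graph.abuts b = some v),
        (𝒢.pull b v h).pullback.obj (S v) ≅ T (𝒢.graph.edgeOf b) := fun b v h =>
      if he : 𝒢.graph.edgeOf b ∈ H.edges then
        A'.ψ ⟨b, he⟩ (hH.vtx v) ((H.abuts_mk_eq_some_iff he _).mpr h) ≪≫ eqToIso (hT he).symm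
      else
        eqToIso (pull_obj_eq_transport S b v h (hH.cusp _ he).1 (hH.cusp _ he).2
            (hH.edgeOf_cusp _ he) (hH.abuts_cusp _ he) (hH.eq_cusp (he := he) rfl h).1) ≪≫
          eqToIso (hT' he).symm
    have hψ : ∀ (b : 𝒢.graph.Branch) (v : 𝒢.graph.Vertex) (h : 𝒢.graph.abuts b = some v)
        (he : 𝒢.graph.edgeOf b ∈ H.edges), (ψ b v h).hom =
        (show (𝒢.pull b v h).pullback.obj (S v) ⟶ A'.T ⟨𝒢.graph.edgeOf b, he⟩ from
            (A'.ψ ⟨b, he⟩ (hH.vtx v) ((H.abuts_mk_eq_some_iff he _).mpr h)).hom) ≫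
          eqToHom (hT he).symm := by
      intro b v h he
      change (dite _ _ _ : _ ≅ _).hom = _
      rw [dif_pos he]
      exact rfl
    refine ⟨⟨S, T, ψ⟩, ⟨{ hom := ?_, inv := ?_, hom_inv_id := ?_, inv_hom_id := ?_ }⟩⟩
    · exact
        { fS := fun v => 𝟙 (A'.S v)
          fT := fun e => eqToHom (hT e.2)
          comm := fun b v h => by
            obtain ⟨b, hb⟩ := b
            obtain ⟨v, hv⟩ := v
            have h' : 𝒢.graph.abuts b = some v := (H.abuts_mk_eq_some_iff hb ⟨v, hv⟩).mp h
            change (𝒢.pull b v h').pullback.map (@CategoryStruct.id (𝒢.V v) _ (A'.S ⟨v, hv⟩)) ≫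
                (A'.ψ ⟨b, hb⟩ ⟨v, hv⟩ h).hom = (ψ b v h').hom ≫ eqToHom (hT hb)
            rw [hψ b v h' hb, CategoryTheory.Functor.map_id, Category.id_comp, Category.assoc,
              eqToHom_trans, eqToHom_refl, Category.comp_id]
            exact rfl }
    · exact
        { fS := fun v => 𝟙 (A'.S v)
          fT := fun e => eqToHom (hT e.2).symm
          comm := fun b v h => by
            obtain ⟨b, hb⟩ := b
            obtain ⟨v, hv⟩ := v
            have h' : 𝒢.graph.abuts b = some v := (H.abuts_mk_eq_some_iff hb ⟨v, hv⟩).mp h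
            change (𝒢.pull b v h').pullback.map (@CategoryStruct.id (𝒢.V v) _ (A'.S ⟨v, hv⟩)) ≫
                (ψ b v h').hom = (A'.ψ ⟨b, hb⟩ ⟨v, hv⟩ h).hom ≫ eqToHom (hT hb).symm
            rw [hψ b v h' hb, CategoryTheory.Functor.map_id, Category.id_comp]
            exact rfl }
    · exact BObj.hom_ext _ _ (funext fun v => Category.id_comp _) (funext fun e => by
        change eqToHom (hT e.2) ≫ eqToHom (hT e.2).symm = 𝟙 _
        rw [eqToHom_trans, eqToHom_refl])
    · exact BObj.hom_ext _ _ (funext fun v => Category.id_comp _) (funext fun e => by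
        change eqToHom (hT e.2).symm ≫ eqToHom (hT e.2) = 𝟙 _
        rw [eqToHom_trans, eqToHom_refl])

/-- **Omitting cuspidal edges does not change `B(𝒢)`**: for a cusp omission `H ⊆ 𝔾` the restriction
functor `B(𝒢) ⥤ B(𝒢_H)` is an equivalence of categories ([IUTchI] §2 p. 44 "the omission of cuspidal
edges clearly does not affect … the … fundamental groups"; [SemiAnbd] §2 p. 24).
[cite: Mochizuki2012, IUTchI §2 p.44] -/
theorem isEquivalence_restrictFunctor (hH : H.IsCuspOmission) :
    (𝒢.restrictFunctor H).IsEquivalence where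
  faithful := faithful_restrictFunctor hH
  full := full_restrictFunctor hH
  essSurj := essSurj_restrictFunctor hH

/-! ### Fundamental groups: `Π_{𝒢_H} ⥲ Π_𝒢` ([SemiAnbd] p. 24; [IUTchI] §2 p. 44) -/

/-- **`Π̂` is unchanged by cusp omission**: `Π_{𝒢_H} → Π_𝒢` ([SemiAnbd] p. 24, the basepoints taken
through a vertex `v`) is bijective. [cite: Mochizuki2012, IUTchI §2 p.44] -/
theorem piHToPi_bijective (hH : H.IsCuspOmission) (v : H.toSemiGraph.Vertex)
    (F : 𝒢.V v.1 ⥤ FintypeCat.{w}) : Function.Bijective (𝒢.piHToPi H v F) := by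
  haveI := isEquivalence_restrictFunctor hH
  exact ⟨pi1Map_injective_of_isEquivalence _ _, pi1Map_surjective_of_isEquivalence _ _⟩

/-- `Π_{𝒢_H} ⥲ Π_𝒢` as an isomorphism of profinite (topological) groups.
[cite: Mochizuki2012, IUTchI §2 p.44] -/
theorem exists_continuousMulEquiv_piHToPi (hH : H.IsCuspOmission) (v : H.toSemiGraph.Vertex)
    (F : 𝒢.V v.1 ⥤ FintypeCat.{w}) :
    ∃ e : 𝒢.PiH H v F ≃ₜ* 𝒢.Pi v.1 F, ∀ σ, e σ = 𝒢.piHToPi H v F σ := by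
  let e₀ : 𝒢.PiH H v F ≃* 𝒢.Pi v.1 F :=
    MulEquiv.ofBijective (𝒢.piHToPi H v F) (piHToPi_bijective hH v F)
  have he₀ : Continuous e₀ := continuous_pi1Map' _ _
  let eₜ : 𝒢.PiH H v F ≃ₜ 𝒢.Pi v.1 F :=
    Continuous.homeoOfEquivCompactToT2 (f := e₀.toEquiv) he₀
  exact ⟨{ e₀ with continuous_toFun := he₀, continuous_invFun := eₜ.symm.continuous },
    fun σ => rfl⟩

/-- Compatibility with the vertex groups: `Π_v → Π_{𝒢_H} → Π_𝒢` is `Π_v → Π_𝒢` (the constituent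
anabelioid at `v` being the same, `restrict_V`); universe-polymorphic private copy of
`CommensurabilityProofs4.piHToPi_comp_piVToPi`. [cite: MochizukiSemiAnbd2006, Def. 2.1 p.24] -/
private theorem piHToPi_comp_piVToPi' (H : 𝒢.graph.Subgraph) (v : H.toSemiGraph.Vertex)
    (F : 𝒢.V v.1 ⥤ FintypeCat.{w}) :
    (𝒢.piHToPi H v F).comp ((𝒢.restrict H).piVToPi v F) = 𝒢.piVToPi v.1 F := by
  ext σ A : 4
  rfl

/-- The image of `Π_v` in `Π_𝒢` is the image under `Π_{𝒢_H} → Π_𝒢` of its image in `Π_{𝒢_H}`.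
[cite: MochizukiSemiAnbd2006, Def. 2.1 p.24] -/
theorem range_piVToPi_eq_map (H : 𝒢.graph.Subgraph) (v : H.toSemiGraph.Vertex)
    (F : 𝒢.V v.1 ⥤ FintypeCat.{w}) :
    (𝒢.piVToPi v.1 F).range = ((𝒢.restrict H).piVToPi v F).range.map (𝒢.piHToPi H v F) := by
  rw [← piHToPi_comp_piVToPi' H v F]
  exact MonoidHom.range_comp _ _

/-- Membership in a conjugate subgroup (private bookkeeping). [folklore] -/
private theorem mem_conjAct_smul_iff' {G : Type*} [Group G] (g x : G) (K : Subgroup G) :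
    x ∈ ConjAct.toConjAct g • K ↔ g⁻¹ * x * g ∈ K := by
  rw [Subgroup.mem_pointwise_smul_iff_inv_smul_mem, ← map_inv, ConjAct.smul_def,
    ConjAct.ofConjAct_toConjAct, inv_inv]

/-- Conjugates are carried to conjugates by a homomorphism — private copy of
`CommensurableTerminalityLemmas.map_conjAct_smul` (not imported, to keep this module's imports
light). [cite: MochizukiSemiAnbd2006, §0 p.5] -/
private theorem map_conjAct_smul_eq {G G' : Type*} [Group G] [Group G'] (f : G →* G') (g : G)
    (K : Subgroup G) : (ConjAct.toConjAct g • K).map f = ConjAct.toConjAct (f g) • K.map f := by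
  ext y
  constructor
  · rintro ⟨x, hx, rfl⟩
    rw [SetLike.mem_coe, mem_conjAct_smul_iff'] at hx
    rw [mem_conjAct_smul_iff', Subgroup.mem_map]
    exact ⟨g⁻¹ * x * g, hx, by simp only [map_mul, map_inv]⟩
  · intro hy
    rw [mem_conjAct_smul_iff', Subgroup.mem_map] at hy
    obtain ⟨x, hx, hxy⟩ := hy
    refine ⟨g * x * g⁻¹, ?_, ?_⟩
    · rw [SetLike.mem_coe, mem_conjAct_smul_iff']
      simpa [mul_assoc] using hx
    · simp only [map_mul, map_inv, hxy]
      group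

/-- The commensurator `C_G(H)` of [SemiAnbd] §0 p. 5 is equivariant under isomorphisms of groups:
`C_{G'}(f(K)) = f(C_G(K))` for a bijective homomorphism `f : G → G'`.
[cite: MochizukiSemiAnbd2006, §0 p.5] -/
theorem commensurator_map_of_bijective {G G' : Type*} [Group G] [Group G'] (f : G →* G')
    (hf : Function.Bijective f) (K : Subgroup G) :
    Subgroup.Commensurable.commensurator (K.map f) =
      (Subgroup.Commensurable.commensurator K).map f := by
  ext y
  obtain ⟨x, rfl⟩ := hf.2 y
  rw [Subgroup.mem_map_iff_mem hf.1, Subgroup.Commensurable.commensurator_mem_iff,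
    Subgroup.Commensurable.commensurator_mem_iff, ← map_conjAct_smul_eq]
  simp only [Subgroup.Commensurable, Subgroup.relIndex_map_map_of_injective _ _ hf.1]

/-- **Commensurable terminality of `Π_v` can be checked after cusp omission**: `Π_v` is commensurably
terminal in `Π_{𝒢_H}` iff it is so in `Π_𝒢` (transport along `Π_{𝒢_H} ⥲ Π_𝒢`) — the form in which
[SemiAnbd] Cor. 2.7 (i) applies to a semi-graph of anabelioids with cusps ([IUTchI] §2 p. 44).
[cite: Mochizuki2012, IUTchI §2 p.44] -/
theorem isCommensurablyTerminal_range_piVToPi_iff (hH : H.IsCuspOmission) (v : H.toSemiGraph.Vertex)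
    (F : 𝒢.V v.1 ⥤ FintypeCat.{w}) :
    AbsoluteAnabelian.IsCommensurablyTerminal ((𝒢.restrict H).piVToPi v F).range ↔
      AbsoluteAnabelian.IsCommensurablyTerminal (𝒢.piVToPi v.1 F).range := by
  have hbij := piHToPi_bijective hH v F
  have h1 := range_piVToPi_eq_map H v F
  have h2 := commensurator_map_of_bijective (𝒢.piHToPi H v F) hbij
    ((𝒢.restrict H).piVToPi v F).range
  rw [AbsoluteAnabelian.isCommensurablyTerminal_iff, AbsoluteAnabelian.isCommensurablyTerminal_iff,
    h1, h2]
  exact (Subgroup.map_injective hbij.1).eq_iff.symm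

/-! ### The maximal subgraph yields a connected graph of anabelioids -/

/-- After omitting all open edges one has a GRAPH of anabelioids: every branch of a closed edge
abuts, and to a kept vertex ([SemiAnbd] §1 p. 13; [IUTchI] §2 p. 44 "`ℋ` 'is' a semi-graph of
anabelioids of pro-`Σ` PSC-type" after cusp omission). [cite: MochizukiSemiAnbd2006, §1 p.13] -/
theorem isGraphOfAnabelioids_restrict_maximalSubgraph (𝒢 : SemiGraphOfAnabelioids.{v₁, u₁, u}) :
    (𝒢.restrict 𝒢.graph.maximalSubgraph).IsGraphOfAnabelioids :=
  ⟨𝒢.graph.isGraph_maximalSubgraph⟩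

/-- After omitting all open edges of a connected semi-graph of anabelioids with a vertex one still
has a CONNECTED semi-graph of anabelioids. [cite: MochizukiSemiAnbd2006, §1 p.13] -/
theorem isConnected_restrict_maximalSubgraph (𝒢 : SemiGraphOfAnabelioids.{v₁, u₁, u})
    (h𝒢 : 𝒢.IsConnected) (hV : Nonempty 𝒢.graph.Vertex) :
    (𝒢.restrict 𝒢.graph.maximalSubgraph).IsConnected :=
  ⟨𝒢.graph.isConnected_maximalSubgraph h𝒢.isConnected hV⟩

/-- For a cusp omission `H` of a connected `𝒢`, `𝒢_H` is connected.
[cite: MochizukiSemiAnbd2006, §1 p.13] -/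
theorem isConnected_restrict_of_isCuspOmission (hH : H.IsCuspOmission) (h𝒢 : 𝒢.IsConnected) :
    (𝒢.restrict H).IsConnected :=
  ⟨hH.isConnected h𝒢.isConnected⟩

end SemiGraphOfAnabelioids

end Literature.AnabelianGeometry.SemiGraphs
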